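import Summits.AtomisticToContinuum.BoseEinsteinCondensation.Theorems.BoxCountShadow
import Literature.MathematicalPhysics.QuantumManyBody.LiebYngvasonCellMethod
import HarnessLib

/-!
# BoxCountShadowCellEnergy — the Lieb–Yngvason cell decomposition in COUNT language (S1 of the CoercivityLine)

For a Dirichlet trial state `Ψ` of `N` bosons in `Λ_L` and `K ≥ 1` horizon cells per axis (side `ℓ = L/K`),
`∫ F_K(X) |Ψ(X)|² dX ≤ ⟨Ψ, H_N Ψ⟩` with `F_K(X) = Σ_B E₀^N(N_B(X), ℓ)` the sum of the NEUMANN ground-state energies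
of the cell occupation numbers `N_B(X) = countVec ℓ K X B` of the configuration ([LSSY2005, (2.52)–(2.53)]: drop the
inter-cell interaction, Neumann conditions on every cell).  On each cell-assignment set `cellSet K ℓ σ` this is the
tree theorem `sum_neumannGroundStateEnergy_mul_le_setLIntegral_cellSet`; this file supplies the dictionary between
the count field (`subCell`, `SubIdx K = Fin 3 → Fin K`) and the cell assignments (`cellCorner`, `cellCoord`,
`Fin (K³)`), and sums over `σ` along the a.e. partition `boxN_ae_eq_iUnion_cellSet`.

This is stub S1 `CellDecomposition` of the COERC_h skeleton (`GroundStateHorizonCellCoercivity`, node g36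
«DensityCoercivity»), now a theorem: `cellDecomposition_holds`.  No instances, no notation, no sorry.
-/

noncomputable section

open MeasureTheory Filter Set
open scoped ENNReal NNReal BigOperators

namespace Summit.AtomisticToContinuum.BoseEinsteinCondensation.Theorems.BoxCountShadow

open Literature.MathematicalPhysics.QuantumManyBody.BoseGas

variable {N : ℕ}

/-- `F_K(X) = Σ_B E₀^N(N_B(X), L/K)`: the sum over the `K³` cells of side `L/K` of the Neumann ground-state energies of
the cell occupation numbers of `X`. [cite: LSSY2005, (2.52)–(2.53)] -/
def cellEnergySum (v : ℝ → ℝ≥0∞) (L : ℝ) (K : ℕ) (X : Config N) : ℝ≥0∞ :=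
  ∑ B : SubIdx K, neumannGroundStateEnergy v (countVec (L / (K : ℝ)) K X B) (L / (K : ℝ))

/-- **Dictionary**: on the cell-assignment set `cellSet K ℓ σ` (particle `i` in the open cell `σ i`), the count of the
half-open cell `B` is the number of particles assigned to the cell with coordinates `B`. [cite: LSSY2005, (2.52)] -/
theorem countVec_eq_card_of_mem_cellSet {ℓ : ℝ} (hℓ : 0 < ℓ) {K : ℕ} {σ : Fin N → Fin (K ^ 3)} {X : Config N}
    (hX : X ∈ cellSet K ℓ σ) (B : SubIdx K) :
    countVec ℓ K X B = (Finset.univ.filter fun i => cellCoord K (σ i) = B).card := by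
  have hmem : ∀ i, X i ∈ subCell ℓ (cellCoord K (σ i)) := by
    intro i
    rw [mem_subCell]
    intro k
    have h := hX i k
    simp only [PiLp.sub_apply, cellCorner_apply, Set.mem_Ioo] at h
    constructor <;> linarith [h.1, h.2]
  unfold countVec
  rw [Finset.card_filter]
  refine Finset.sum_congr rfl fun i _ => ?_
  by_cases hB : cellCoord K (σ i) = B
  · rw [if_pos hB, Set.indicator_of_mem (hB ▸ hmem i)]
  · rw [if_neg hB, Set.indicator_of_notMem (not_mem_subCell_of_ne hℓ hB (hmem i))]

/-- Hence `F_K` is constant on each cell-assignment set, equal to `Σ_c E₀^N(#{i : σ i = c}, ℓ)` (re-index the cells by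
`finFunctionFinEquiv : (Fin 3 → Fin K) ≃ Fin (K³)`). [cite: LSSY2005, (2.52)–(2.53)] -/
theorem cellEnergySum_eq_of_mem_cellSet (v : ℝ → ℝ≥0∞) {L : ℝ} (hL : 0 < L) {K : ℕ} (hK : 0 < K)
    {σ : Fin N → Fin (K ^ 3)} {X : Config N} (hX : X ∈ cellSet K (L / (K : ℝ)) σ) :
    cellEnergySum v L K X =
      ∑ c : Fin (K ^ 3), neumannGroundStateEnergy v (Finset.univ.filter fun i => σ i = c).card (L / (K : ℝ)) := by
  have hℓ : 0 < L / (K : ℝ) := div_pos hL (Nat.cast_pos.2 hK)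
  unfold cellEnergySum
  simp_rw [countVec_eq_card_of_mem_cellSet hℓ hX]
  refine Fintype.sum_equiv finFunctionFinEquiv _ _ fun B => ?_
  congr 2
  refine Finset.filter_congr fun i _ => ?_
  simp only [cellCoord]
  rw [Equiv.symm_apply_eq]

/-- **The cell decomposition in count language** ([LSSY2005, (2.52)–(2.53)]): for every Dirichlet trial state `Ψ` of
`N` bosons in `Λ_L`, every measurable `v ≥ 0` and every `K ≥ 1`, `∫ F_K(X) |Ψ(X)|² dX ≤ ⟨Ψ, H_N Ψ⟩`.
[cite: LSSY2005, (2.52)–(2.53)] -/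
theorem lintegral_cellEnergySum_mul_le_energy {v : ℝ → ℝ≥0∞} (hv : Measurable v) {L : ℝ} (hL : 0 < L)
    {K : ℕ} (hK : 0 < K) (Ψ : TrialState N L) :
    ∫⁻ X, cellEnergySum v L K X * (‖Ψ.ψ X‖₊ : ℝ≥0∞) ^ 2 ≤ energy v Ψ := by
  set ℓ : ℝ := L / (K : ℝ) with hℓdef
  have hKr : (0 : ℝ) < K := Nat.cast_pos.2 hK
  have hℓ : 0 < ℓ := div_pos hL hKr
  have hKℓ : (K : ℝ) * ℓ = L := mul_div_cancel₀ L hKr.ne'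
  have hψm : Measurable Ψ.ψ := Ψ.contDiff.continuous.measurable
  have hgm : Measurable fun X => (‖Ψ.ψ X‖₊ : ℝ≥0∞) ^ 2 := (hψm.nnnorm.coe_nnreal_ennreal).pow_const 2
  -- Step 1: the integrand vanishes off the box
  have step1 : ∫⁻ X, cellEnergySum v L K X * (‖Ψ.ψ X‖₊ : ℝ≥0∞) ^ 2 =
      ∫⁻ X in boxN N ((K : ℝ) * ℓ), cellEnergySum v L K X * (‖Ψ.ψ X‖₊ : ℝ≥0∞) ^ 2 := by
    rw [hKℓ, ← lintegral_indicator (measurableSet_boxN N L)]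
    refine lintegral_congr fun X => ?_
    by_cases hX : X ∈ boxN N L
    · rw [Set.indicator_of_mem hX]
    · rw [Set.indicator_of_notMem hX, Ψ.eq_zero X hX]
      simp
  -- Step 2: split the box into the cell-assignment sets (an a.e. partition)
  rw [step1, setLIntegral_congr (boxN_ae_eq_iUnion_cellSet (N := N) hℓ hK),
    lintegral_iUnion (fun σ => measurableSet_cellSet K ℓ σ) (pairwiseDisjoint_cellSet hℓ), tsum_fintype]
  -- Step 3: on each cell-assignment set, `F_K` is the constant of the tree theorem
  have hσ : ∀ σ : Fin N → Fin (K ^ 3),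
      ∫⁻ X in cellSet K ℓ σ, cellEnergySum v L K X * (‖Ψ.ψ X‖₊ : ℝ≥0∞) ^ 2 ≤
        ∫⁻ X in cellSet K ℓ σ, kineticDensity Ψ.ψ X + interaction v X * (‖Ψ.ψ X‖₊ : ℝ≥0∞) ^ 2 := by
    intro σ
    calc ∫⁻ X in cellSet K ℓ σ, cellEnergySum v L K X * (‖Ψ.ψ X‖₊ : ℝ≥0∞) ^ 2
        = ∫⁻ X in cellSet K ℓ σ, (∑ c : Fin (K ^ 3),
            neumannGroundStateEnergy v (Finset.univ.filter fun i => σ i = c).card ℓ) *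
              (‖Ψ.ψ X‖₊ : ℝ≥0∞) ^ 2 :=
          setLIntegral_congr_fun (measurableSet_cellSet K ℓ σ) fun X hX => by
            rw [cellEnergySum_eq_of_mem_cellSet v hL hK hX]
      _ = (∑ c : Fin (K ^ 3), neumannGroundStateEnergy v (Finset.univ.filter fun i => σ i = c).card ℓ) *
            ∫⁻ X in cellSet K ℓ σ, (‖Ψ.ψ X‖₊ : ℝ≥0∞) ^ 2 := lintegral_const_mul _ hgm
      _ ≤ _ := sum_neumannGroundStateEnergy_mul_le_setLIntegral_cellSet hv Ψ.contDiff σ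
  -- Step 4: reassemble
  calc ∑ σ : Fin N → Fin (K ^ 3), ∫⁻ X in cellSet K ℓ σ, cellEnergySum v L K X * (‖Ψ.ψ X‖₊ : ℝ≥0∞) ^ 2
      ≤ ∑ σ : Fin N → Fin (K ^ 3), ∫⁻ X in cellSet K ℓ σ,
          kineticDensity Ψ.ψ X + interaction v X * (‖Ψ.ψ X‖₊ : ℝ≥0∞) ^ 2 :=
        Finset.sum_le_sum fun σ _ => hσ σ
    _ = ∫⁻ X in ⋃ σ : Fin N → Fin (K ^ 3), cellSet K ℓ σ,
          kineticDensity Ψ.ψ X + interaction v X * (‖Ψ.ψ X‖₊ : ℝ≥0∞) ^ 2 := by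
        rw [lintegral_iUnion (fun σ => measurableSet_cellSet K ℓ σ) (pairwiseDisjoint_cellSet hℓ),
          tsum_fintype]
    _ ≤ energy v Ψ := setLIntegral_le_lintegral _ _

/-- **S1 of the CoercivityLine, as a closed statement** (the shape registered in the COERC_h skeleton). [cite: LSSY2005, (2.52)–(2.53)] -/
theorem cellDecomposition_holds :
    ∀ v : ℝ → ℝ≥0∞, Measurable v → ∀ (n : ℕ) (L : ℝ), 0 < L → ∀ K : ℕ, 0 < K →
      ∀ Ψ : TrialState (n + 1) L,
        ∫⁻ X, cellEnergySum v L K X * (‖Ψ.ψ X‖₊ : ℝ≥0∞) ^ 2 ≤ energy v Ψ :=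
  fun _ hv _ _ hL _ hK Ψ => lintegral_cellEnergySum_mul_le_energy hv hL hK Ψ

end Summit.AtomisticToContinuum.BoseEinsteinCondensation.Theorems.BoxCountShadow

end
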